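import Summits.CriticalPhenomena.PercolationContinuityZ3.Theorems.PercNearOneGluingNoHeavyLowerTailSahiOneStepFreeExtension
import Literature.Probability.LatticeModels.ProdBernoulliClusterLocality
import HarnessLib

/-!
# Density monotonicity of the Harris covariance ("tilt-shrink")

Support file (prover prim-ineq-prove-3 gen 22; `--supports stmt-CriticalPhenomena-4575`; memo
`run/shared/lean/prim/prim-ineq-prove-3/FINDING-G22-PIVOT-TILT.md` §2).  No definitions, no named facts, no sorries, no `native_decide`.

Setting: `μ_p = prodBernoulli p` on `Set ι` (`ι` finite), `A, B` increasing events, `Cov_p(A,B) = μ_p(A ∩ B) − μ_p(A) μ_p(B) ≥ 0` (Harris).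
For two parameter vectors `p' ≤ p` (coordinatewise):

* `cov_mul_le_cov_mul_of_agree_off` — ONE coordinate `e` (`p' = p` off `e`, `p' e ≤ p e`):
  `(1 − p e)·Cov_{p'}(A,B) ≤ (1 − p' e)·Cov_p(A,B)`; the proof is the identity
  `(1 − p'_e)Cov_p − (1 − p_e)Cov_{p'} = (p_e − p'_e)·[Cov(A¹,B¹) + (1 − p_e)(1 − p'_e)(μA¹ − μA⁰)(μB¹ − μB⁰)]`
  on the common (`e`-free) sections `X¹ = {insert e ω ∈ X}`, `X⁰ = {ω ∖ {e} ∈ X}`, plus Harris for `(A¹,B¹)`;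
* `cov_mul_le_cov_mul_of_agree_off'` — dually `p' e·Cov_p(A,B) ≤ p e·Cov_{p'}(A,B)`;
* **`prod_mul_cov_le_prod_mul_cov`** — `(∏_i (1 − p_i))·Cov_{p'}(A,B) ≤ (∏_i (1 − p'_i))·Cov_p(A,B)`, i.e. `p ↦ Cov_p(A,B)/∏(1 − p_i)`
  is coordinatewise non-decreasing; **`prod_mul_cov_le_prod_mul_cov'`** — `(∏_i p'_i)·Cov_p(A,B) ≤ (∏_i p_i)·Cov_{p'}(A,B)`,
  i.e. `p ↦ Cov_p(A,B)/∏ p_i` is non-increasing.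
With `p'_i = p_iθ_i/(1 − p_i + p_iθ_i)` (`θ_i ∈ [0,1]`) the first statement reads `Cov_p(A,B) ≥ E_p[∏ θ_i^{ω_i}]·Cov_{p'}(A,B)` where
`μ_{p'} = ` the `∏θ_i^{ω_i}`-reweighting of `μ_p`: the covariance of two increasing events SHRINKS at least by the factor `E[w]` under a
product-form ("tilt") log-concave reweighting `w` — the first proved instance of the log-concave reweighting conjecture of the memo (§3),
whose Hamming-ball instance `w = 1_{N ≤ s}` is the `(2′)` half `0 ≤ osN` of the one-step scheme (`…SahiOneStepCone`).
-/

noncomputable section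

namespace Summit.CriticalPhenomena.PercolationContinuityZ3.Theorems

namespace SahiOneStep

open MeasureTheory
open Literature.Probability.Percolation (DeterminedBy)
open Literature.Probability.LatticeModels (prodBernoulli prodBernoulli_harris prodBernoulli_real_eq_of_determinedBy)
open SahiE3Sections (determinedBy_section_insert_compl determinedBy_section_sdiff_compl)
open scoped Classical

variable {ι : Type*} [Fintype ι]

/-! ## Sections do not see the density at the removed coordinate -/

/-- If `p, p'` agree off `e`, the inner section `{insert e ω ∈ X}` has the same mass under both product measures. [folklore] -/
theorem real_section_insert_eq_of_agree_off (p p' : ι → unitInterval) (e : ι) (h : ∀ i, i ≠ e → p' i = p i)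
    (X : Set (Set ι)) :
    (prodBernoulli p').real {ω : Set ι | insert e ω ∈ X} = (prodBernoulli p).real {ω : Set ι | insert e ω ∈ X} :=
  prodBernoulli_real_eq_of_determinedBy p' p (F := ((({e} : Finset ι) : Set ι)ᶜ))
    (fun i hi => h i (by simpa using hi)) (determinedBy_section_insert_compl X e) MeasurableSet.of_discrete

/-- If `p, p'` agree off `e`, the outer section `{ω ∖ {e} ∈ X}` has the same mass under both product measures. [folklore] -/
theorem real_section_sdiff_eq_of_agree_off (p p' : ι → unitInterval) (e : ι) (h : ∀ i, i ≠ e → p' i = p i)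
    (X : Set (Set ι)) :
    (prodBernoulli p').real {ω : Set ι | ω \ {e} ∈ X} = (prodBernoulli p).real {ω : Set ι | ω \ {e} ∈ X} :=
  prodBernoulli_real_eq_of_determinedBy p' p (F := ((({e} : Finset ι) : Set ι)ᶜ))
    (fun i hi => h i (by simpa using hi)) (determinedBy_section_sdiff_compl X e) MeasurableSet.of_discrete

/-! ## One coordinate -/

/-- **One-coordinate tilt monotonicity.**  If `p' = p` off `e` and `p' e ≤ p e`, then for increasing `A, B`:
`(1 − p e)·Cov_{p'}(A,B) ≤ (1 − p' e)·Cov_p(A,B)`. [this work] -/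
theorem cov_mul_le_cov_mul_of_agree_off (p p' : ι → unitInterval) (e : ι) (h : ∀ i, i ≠ e → p' i = p i)
    (hle : p' e ≤ p e) {A B : Set (Set ι)} (hA : IsUpperSet A) (hB : IsUpperSet B) :
    (1 - (p e : ℝ)) * ((prodBernoulli p').real (A ∩ B) - (prodBernoulli p').real A * (prodBernoulli p').real B) ≤
      (1 - (p' e : ℝ)) * ((prodBernoulli p).real (A ∩ B) - (prodBernoulli p).real A * (prodBernoulli p).real B) := by
  -- sections (all measured under `p`)
  have sA := real_split p e A
  have sB := real_split p e B
  have sAB := real_split p e (A ∩ B)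
  have sA' := real_split p' e A
  rw [real_section_insert_eq_of_agree_off p p' e h A, real_section_sdiff_eq_of_agree_off p p' e h A] at sA'
  have sB' := real_split p' e B
  rw [real_section_insert_eq_of_agree_off p p' e h B, real_section_sdiff_eq_of_agree_off p p' e h B] at sB'
  have sAB' := real_split p' e (A ∩ B)
  rw [real_section_insert_eq_of_agree_off p p' e h (A ∩ B), real_section_sdiff_eq_of_agree_off p p' e h (A ∩ B)] at sAB'
  rw [section_insert_inter, section_sdiff_inter] at sAB sAB'
  -- Harris on the inner sections, monotonicity outer ⊆ inner
  have hH := prodBernoulli_harris p (isUpperSet_section_insert hA e) (isUpperSet_section_insert hB e)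
    MeasurableSet.of_discrete MeasurableSet.of_discrete
  have mA : (prodBernoulli p).real {ω : Set ι | ω \ {e} ∈ A} ≤ (prodBernoulli p).real {ω : Set ι | insert e ω ∈ A} :=
    measureReal_mono (section_sdiff_subset_section_insert hA e)
  have mB : (prodBernoulli p).real {ω : Set ι | ω \ {e} ∈ B} ≤ (prodBernoulli p).real {ω : Set ι | insert e ω ∈ B} :=
    measureReal_mono (section_sdiff_subset_section_insert hB e)
  have hpe : (p' e : ℝ) ≤ p e := by exact_mod_cast hle
  have q0 : 0 ≤ 1 - (p e : ℝ) := sub_nonneg.2 (p e).2.2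
  have q0' : 0 ≤ 1 - (p' e : ℝ) := sub_nonneg.2 (p' e).2.2
  rw [sA, sB, sAB, sA', sB', sAB']
  -- the difference is `(p e − p' e)·[Harris slack of the inner sections + (1−p e)(1−p' e)·(μA¹−μA⁰)(μB¹−μB⁰)]`
  have key : (1 - (p' e : ℝ)) * ((p e : ℝ) * (prodBernoulli p).real ({ω : Set ι | insert e ω ∈ A} ∩ {ω : Set ι | insert e ω ∈ B}) +
        (1 - p e) * (prodBernoulli p).real ({ω : Set ι | ω \ {e} ∈ A} ∩ {ω : Set ι | ω \ {e} ∈ B}) -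
        ((p e : ℝ) * (prodBernoulli p).real {ω : Set ι | insert e ω ∈ A} + (1 - p e) * (prodBernoulli p).real {ω : Set ι | ω \ {e} ∈ A}) *
          ((p e : ℝ) * (prodBernoulli p).real {ω : Set ι | insert e ω ∈ B} + (1 - p e) * (prodBernoulli p).real {ω : Set ι | ω \ {e} ∈ B})) -
      (1 - (p e : ℝ)) * ((p' e : ℝ) * (prodBernoulli p).real ({ω : Set ι | insert e ω ∈ A} ∩ {ω : Set ι | insert e ω ∈ B}) +
        (1 - p' e) * (prodBernoulli p).real ({ω : Set ι | ω \ {e} ∈ A} ∩ {ω : Set ι | ω \ {e} ∈ B}) -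
        ((p' e : ℝ) * (prodBernoulli p).real {ω : Set ι | insert e ω ∈ A} + (1 - p' e) * (prodBernoulli p).real {ω : Set ι | ω \ {e} ∈ A}) *
          ((p' e : ℝ) * (prodBernoulli p).real {ω : Set ι | insert e ω ∈ B} + (1 - p' e) * (prodBernoulli p).real {ω : Set ι | ω \ {e} ∈ B})) =
      ((p e : ℝ) - p' e) * (((prodBernoulli p).real ({ω : Set ι | insert e ω ∈ A} ∩ {ω : Set ι | insert e ω ∈ B}) -
          (prodBernoulli p).real {ω : Set ι | insert e ω ∈ A} * (prodBernoulli p).real {ω : Set ι | insert e ω ∈ B}) +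
        (1 - p e) * (1 - p' e) * (((prodBernoulli p).real {ω : Set ι | insert e ω ∈ A} - (prodBernoulli p).real {ω : Set ι | ω \ {e} ∈ A}) *
          ((prodBernoulli p).real {ω : Set ι | insert e ω ∈ B} - (prodBernoulli p).real {ω : Set ι | ω \ {e} ∈ B}))) := by
    ring
  have hnn : 0 ≤ ((p e : ℝ) - p' e) * (((prodBernoulli p).real ({ω : Set ι | insert e ω ∈ A} ∩ {ω : Set ι | insert e ω ∈ B}) -
          (prodBernoulli p).real {ω : Set ι | insert e ω ∈ A} * (prodBernoulli p).real {ω : Set ι | insert e ω ∈ B}) +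
        (1 - p e) * (1 - p' e) * (((prodBernoulli p).real {ω : Set ι | insert e ω ∈ A} - (prodBernoulli p).real {ω : Set ι | ω \ {e} ∈ A}) *
          ((prodBernoulli p).real {ω : Set ι | insert e ω ∈ B} - (prodBernoulli p).real {ω : Set ι | ω \ {e} ∈ B}))) :=
    mul_nonneg (sub_nonneg.2 hpe) (add_nonneg (sub_nonneg.2 hH)
      (mul_nonneg (mul_nonneg q0 q0') (mul_nonneg (sub_nonneg.2 mA) (sub_nonneg.2 mB))))
  linarith [key, hnn]

/-- **One-coordinate tilt monotonicity, dual form.**  If `p' = p` off `e` and `p' e ≤ p e`, then for increasing `A, B`: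
`p' e·Cov_p(A,B) ≤ p e·Cov_{p'}(A,B)`. [this work] -/
theorem cov_mul_le_cov_mul_of_agree_off' (p p' : ι → unitInterval) (e : ι) (h : ∀ i, i ≠ e → p' i = p i)
    (hle : p' e ≤ p e) {A B : Set (Set ι)} (hA : IsUpperSet A) (hB : IsUpperSet B) :
    (p' e : ℝ) * ((prodBernoulli p).real (A ∩ B) - (prodBernoulli p).real A * (prodBernoulli p).real B) ≤
      (p e : ℝ) * ((prodBernoulli p').real (A ∩ B) - (prodBernoulli p').real A * (prodBernoulli p').real B) := by
  have sA := real_split p e A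
  have sB := real_split p e B
  have sAB := real_split p e (A ∩ B)
  have sA' := real_split p' e A
  rw [real_section_insert_eq_of_agree_off p p' e h A, real_section_sdiff_eq_of_agree_off p p' e h A] at sA'
  have sB' := real_split p' e B
  rw [real_section_insert_eq_of_agree_off p p' e h B, real_section_sdiff_eq_of_agree_off p p' e h B] at sB'
  have sAB' := real_split p' e (A ∩ B)
  rw [real_section_insert_eq_of_agree_off p p' e h (A ∩ B), real_section_sdiff_eq_of_agree_off p p' e h (A ∩ B)] at sAB'
  rw [section_insert_inter, section_sdiff_inter] at sAB sAB'
  have hH := prodBernoulli_harris p (isUpperSet_section_sdiff hA e) (isUpperSet_section_sdiff hB e)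
    MeasurableSet.of_discrete MeasurableSet.of_discrete
  have mA : (prodBernoulli p).real {ω : Set ι | ω \ {e} ∈ A} ≤ (prodBernoulli p).real {ω : Set ι | insert e ω ∈ A} :=
    measureReal_mono (section_sdiff_subset_section_insert hA e)
  have mB : (prodBernoulli p).real {ω : Set ι | ω \ {e} ∈ B} ≤ (prodBernoulli p).real {ω : Set ι | insert e ω ∈ B} :=
    measureReal_mono (section_sdiff_subset_section_insert hB e)
  have hpe : (p' e : ℝ) ≤ p e := by exact_mod_cast hle
  have p0 : 0 ≤ (p e : ℝ) := (p e).2.1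
  have p0' : 0 ≤ (p' e : ℝ) := (p' e).2.1
  rw [sA, sB, sAB, sA', sB', sAB']
  have key : (p e : ℝ) * ((p' e : ℝ) * (prodBernoulli p).real ({ω : Set ι | insert e ω ∈ A} ∩ {ω : Set ι | insert e ω ∈ B}) +
        (1 - p' e) * (prodBernoulli p).real ({ω : Set ι | ω \ {e} ∈ A} ∩ {ω : Set ι | ω \ {e} ∈ B}) -
        ((p' e : ℝ) * (prodBernoulli p).real {ω : Set ι | insert e ω ∈ A} + (1 - p' e) * (prodBernoulli p).real {ω : Set ι | ω \ {e} ∈ A}) *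
          ((p' e : ℝ) * (prodBernoulli p).real {ω : Set ι | insert e ω ∈ B} + (1 - p' e) * (prodBernoulli p).real {ω : Set ι | ω \ {e} ∈ B})) -
      (p' e : ℝ) * ((p e : ℝ) * (prodBernoulli p).real ({ω : Set ι | insert e ω ∈ A} ∩ {ω : Set ι | insert e ω ∈ B}) +
        (1 - p e) * (prodBernoulli p).real ({ω : Set ι | ω \ {e} ∈ A} ∩ {ω : Set ι | ω \ {e} ∈ B}) -
        ((p e : ℝ) * (prodBernoulli p).real {ω : Set ι | insert e ω ∈ A} + (1 - p e) * (prodBernoulli p).real {ω : Set ι | ω \ {e} ∈ A}) *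
          ((p e : ℝ) * (prodBernoulli p).real {ω : Set ι | insert e ω ∈ B} + (1 - p e) * (prodBernoulli p).real {ω : Set ι | ω \ {e} ∈ B})) =
      ((p e : ℝ) - p' e) * (((prodBernoulli p).real ({ω : Set ι | ω \ {e} ∈ A} ∩ {ω : Set ι | ω \ {e} ∈ B}) -
          (prodBernoulli p).real {ω : Set ι | ω \ {e} ∈ A} * (prodBernoulli p).real {ω : Set ι | ω \ {e} ∈ B}) +
        (p e : ℝ) * (p' e) * (((prodBernoulli p).real {ω : Set ι | insert e ω ∈ A} - (prodBernoulli p).real {ω : Set ι | ω \ {e} ∈ A}) *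
          ((prodBernoulli p).real {ω : Set ι | insert e ω ∈ B} - (prodBernoulli p).real {ω : Set ι | ω \ {e} ∈ B}))) := by
    ring
  have hnn : 0 ≤ ((p e : ℝ) - p' e) * (((prodBernoulli p).real ({ω : Set ι | ω \ {e} ∈ A} ∩ {ω : Set ι | ω \ {e} ∈ B}) -
          (prodBernoulli p).real {ω : Set ι | ω \ {e} ∈ A} * (prodBernoulli p).real {ω : Set ι | ω \ {e} ∈ B}) +
        (p e : ℝ) * (p' e) * (((prodBernoulli p).real {ω : Set ι | insert e ω ∈ A} - (prodBernoulli p).real {ω : Set ι | ω \ {e} ∈ A}) *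
          ((prodBernoulli p).real {ω : Set ι | insert e ω ∈ B} - (prodBernoulli p).real {ω : Set ι | ω \ {e} ∈ B}))) :=
    mul_nonneg (sub_nonneg.2 hpe) (add_nonneg (sub_nonneg.2 hH)
      (mul_nonneg (mul_nonneg p0 p0') (mul_nonneg (sub_nonneg.2 mA) (sub_nonneg.2 mB))))
  linarith [key, hnn]

/-! ## All coordinates -/

/-- **Tilt monotonicity of the Harris covariance.**  For `p' ≤ p` coordinatewise and increasing `A, B`:
`(∏_i (1 − p_i))·Cov_{p'}(A,B) ≤ (∏_i (1 − p'_i))·Cov_p(A,B)` — `Cov_p(A,B)/∏_i(1 − p_i)` is non-decreasing in `p`. [this work] -/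
theorem prod_mul_cov_le_prod_mul_cov (p p' : ι → unitInterval) (hle : ∀ i, p' i ≤ p i) {A B : Set (Set ι)}
    (hA : IsUpperSet A) (hB : IsUpperSet B) :
    (∏ i, (1 - (p i : ℝ))) * ((prodBernoulli p').real (A ∩ B) - (prodBernoulli p').real A * (prodBernoulli p').real B) ≤
      (∏ i, (1 - (p' i : ℝ))) * ((prodBernoulli p).real (A ∩ B) - (prodBernoulli p).real A * (prodBernoulli p).real B) := by
  -- interpolating vectors `pS S = p` on `S`, `= p'` off `S`
  let pS : Finset ι → ι → unitInterval := fun S i => if i ∈ S then p i else p' i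
  have claim : ∀ S : Finset ι,
      (∏ i ∈ S, (1 - (p i : ℝ))) * ((prodBernoulli p').real (A ∩ B) - (prodBernoulli p').real A * (prodBernoulli p').real B) ≤
        (∏ i ∈ S, (1 - (p' i : ℝ))) *
          ((prodBernoulli (pS S)).real (A ∩ B) - (prodBernoulli (pS S)).real A * (prodBernoulli (pS S)).real B) := by
    intro S
    induction S using Finset.induction_on with
    | empty =>
      have h0 : pS ∅ = p' := by funext i; simp [pS]
      rw [h0]; simp
    | insert e S heS ih =>
      have hagree : ∀ i, i ≠ e → pS S i = pS (insert e S) i := by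
        intro i hi; simp [pS, Finset.mem_insert, hi]
      have hle' : pS S e ≤ pS (insert e S) e := by
        simp only [pS, Finset.mem_insert, heS, if_false, true_or, if_true]; exact hle e
      have step := cov_mul_le_cov_mul_of_agree_off (pS (insert e S)) (pS S) e hagree hle' hA hB
      have hpe : (pS (insert e S) e : ℝ) = p e := by simp [pS]
      have hpe' : (pS S e : ℝ) = p' e := by simp [pS, heS]
      rw [hpe, hpe'] at step
      rw [Finset.prod_insert heS, Finset.prod_insert heS]
      have q0 : 0 ≤ 1 - (p e : ℝ) := sub_nonneg.2 (p e).2.2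
      have P0 : 0 ≤ ∏ i ∈ S, (1 - (p' i : ℝ)) := Finset.prod_nonneg fun i _ => sub_nonneg.2 (p' i).2.2
      calc (1 - (p e : ℝ)) * (∏ i ∈ S, (1 - (p i : ℝ))) *
            ((prodBernoulli p').real (A ∩ B) - (prodBernoulli p').real A * (prodBernoulli p').real B)
          = (1 - (p e : ℝ)) * ((∏ i ∈ S, (1 - (p i : ℝ))) *
            ((prodBernoulli p').real (A ∩ B) - (prodBernoulli p').real A * (prodBernoulli p').real B)) := by ring
        _ ≤ (1 - (p e : ℝ)) * ((∏ i ∈ S, (1 - (p' i : ℝ))) *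
            ((prodBernoulli (pS S)).real (A ∩ B) - (prodBernoulli (pS S)).real A * (prodBernoulli (pS S)).real B)) :=
          mul_le_mul_of_nonneg_left ih q0
        _ = (∏ i ∈ S, (1 - (p' i : ℝ))) * ((1 - (p e : ℝ)) *
            ((prodBernoulli (pS S)).real (A ∩ B) - (prodBernoulli (pS S)).real A * (prodBernoulli (pS S)).real B)) := by ring
        _ ≤ (∏ i ∈ S, (1 - (p' i : ℝ))) * ((1 - (p' e : ℝ)) *
            ((prodBernoulli (pS (insert e S))).real (A ∩ B) -
              (prodBernoulli (pS (insert e S))).real A * (prodBernoulli (pS (insert e S))).real B)) :=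
          mul_le_mul_of_nonneg_left step P0
        _ = (1 - (p' e : ℝ)) * (∏ i ∈ S, (1 - (p' i : ℝ))) *
            ((prodBernoulli (pS (insert e S))).real (A ∩ B) -
              (prodBernoulli (pS (insert e S))).real A * (prodBernoulli (pS (insert e S))).real B) := by ring
  have hU : pS Finset.univ = p := by funext i; simp [pS]
  have := claim Finset.univ
  rw [hU] at this
  exact this

/-- **Tilt monotonicity, dual form.**  For `p' ≤ p` coordinatewise and increasing `A, B`:
`(∏_i p'_i)·Cov_p(A,B) ≤ (∏_i p_i)·Cov_{p'}(A,B)` — `Cov_p(A,B)/∏_i p_i` is non-increasing in `p`. [this work] -/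
theorem prod_mul_cov_le_prod_mul_cov' (p p' : ι → unitInterval) (hle : ∀ i, p' i ≤ p i) {A B : Set (Set ι)}
    (hA : IsUpperSet A) (hB : IsUpperSet B) :
    (∏ i, (p' i : ℝ)) * ((prodBernoulli p).real (A ∩ B) - (prodBernoulli p).real A * (prodBernoulli p).real B) ≤
      (∏ i, (p i : ℝ)) * ((prodBernoulli p').real (A ∩ B) - (prodBernoulli p').real A * (prodBernoulli p').real B) := by
  let pS : Finset ι → ι → unitInterval := fun S i => if i ∈ S then p i else p' i
  have claim : ∀ S : Finset ι,
      (∏ i ∈ S, (p' i : ℝ)) *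
          ((prodBernoulli (pS S)).real (A ∩ B) - (prodBernoulli (pS S)).real A * (prodBernoulli (pS S)).real B) ≤
        (∏ i ∈ S, (p i : ℝ)) * ((prodBernoulli p').real (A ∩ B) - (prodBernoulli p').real A * (prodBernoulli p').real B) := by
    intro S
    induction S using Finset.induction_on with
    | empty =>
      have h0 : pS ∅ = p' := by funext i; simp [pS]
      rw [h0]; simp
    | insert e S heS ih =>
      have hagree : ∀ i, i ≠ e → pS S i = pS (insert e S) i := by
        intro i hi; simp [pS, Finset.mem_insert, hi]
      have hle' : pS S e ≤ pS (insert e S) e := by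
        simp only [pS, Finset.mem_insert, heS, if_false, true_or, if_true]; exact hle e
      have step := cov_mul_le_cov_mul_of_agree_off' (pS (insert e S)) (pS S) e hagree hle' hA hB
      have hpe : (pS (insert e S) e : ℝ) = p e := by simp [pS]
      have hpe' : (pS S e : ℝ) = p' e := by simp [pS, heS]
      rw [hpe, hpe'] at step
      rw [Finset.prod_insert heS, Finset.prod_insert heS]
      have p0 : 0 ≤ (p e : ℝ) := (p e).2.1
      have P0 : 0 ≤ ∏ i ∈ S, (p' i : ℝ) := Finset.prod_nonneg fun i _ => (p' i).2.1
      calc (p' e : ℝ) * (∏ i ∈ S, (p' i : ℝ)) *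
            ((prodBernoulli (pS (insert e S))).real (A ∩ B) -
              (prodBernoulli (pS (insert e S))).real A * (prodBernoulli (pS (insert e S))).real B)
          = (∏ i ∈ S, (p' i : ℝ)) * ((p' e : ℝ) *
            ((prodBernoulli (pS (insert e S))).real (A ∩ B) -
              (prodBernoulli (pS (insert e S))).real A * (prodBernoulli (pS (insert e S))).real B)) := by ring
        _ ≤ (∏ i ∈ S, (p' i : ℝ)) * ((p e : ℝ) *
            ((prodBernoulli (pS S)).real (A ∩ B) - (prodBernoulli (pS S)).real A * (prodBernoulli (pS S)).real B)) :=
          mul_le_mul_of_nonneg_left step P0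
        _ = (p e : ℝ) * ((∏ i ∈ S, (p' i : ℝ)) *
            ((prodBernoulli (pS S)).real (A ∩ B) - (prodBernoulli (pS S)).real A * (prodBernoulli (pS S)).real B)) := by ring
        _ ≤ (p e : ℝ) * ((∏ i ∈ S, (p i : ℝ)) *
            ((prodBernoulli p').real (A ∩ B) - (prodBernoulli p').real A * (prodBernoulli p').real B)) :=
          mul_le_mul_of_nonneg_left ih p0
        _ = (p e : ℝ) * (∏ i ∈ S, (p i : ℝ)) *
            ((prodBernoulli p').real (A ∩ B) - (prodBernoulli p').real A * (prodBernoulli p').real B) := by ring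
  have hU : pS Finset.univ = p := by funext i; simp [pS]
  have := claim Finset.univ
  rw [hU] at this
  exact this

end SahiOneStep

end Summit.CriticalPhenomena.PercolationContinuityZ3.Theorems
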